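import Literature.MathematicalPhysics.QuantumFieldTheory.O2OPEScanBridge
import HarnessLib

/-!
# The obligation list of an `O(2)` scan functional (Chester et al. 2020, §3.1 with §2.2)

The verifier-facing form of the `l`-independent half of the functional conditions of
Chester–Landry–Liu–Poland–Simmons-Duffin–Su–Vichi, *Carving out OPE space and precise O(2) model
critical exponents*, JHEP 06 (2020) 142, §3.1, against the spectrum assumptions of §2.2, for ONE
functional `α` at ONE external-dimension point `D = (Δ_s, Δ_φ, Δ_t)`.

`O2ThreeScalarSystem.IsPositiveFor α A D l` packages: the unit normalisation, the external condition at
the OPE class `l`, and seven families of sector conditions "for every `(Δ, ℓ)` admissible in the sector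
(`O2Gaps.Allows0p … Allows4`) and every genuine block family there".  `O2OPEScanBridge` splits off the
external condition (`isPositiveFor_of_zero_of_ext`: only it depends on `l`).  This file splits what is
left, `IsPositiveFor α A D 0`, the way a certificate is organised (exactly as
`ONArchipelagoObligations` does for the `O(N)` archipelago): per sector, at a head threshold `E₀`,

* scalars (`ℓ = 0`) from the sector's threshold (`A.Δ0, A.Δ1, A.Δ2, A.Δ3, A.Δ4`, and the unitarity value
  `1/2`) up to `E₀` — sectors `0⁺, 1, 2⁺, 3, 4` (the odd-spin sectors `0⁻, 2⁻` have no scalars);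
* the two operators the source places EXACTLY: the stress tensor `(ℓ, Δ) = (2, 3)` in `0⁺` and the
  conserved current `(ℓ, Δ) = (1, 2)` in `0⁻` (*"The stress tensor and conserved current are assumed in
  the spectrum"*, §4.2; in `O2Gaps.Allows0p/Allows0m` they are the disjuncts `ℓ = 2 ∧ Δ = 3`,
  `ℓ = 1 ∧ Δ = 2`);
* spinning primaries `ℓ ≥ 1` from the twist threshold `ℓ + 1 + δ_τ` (*"All other operators are allowed to
  exist at any scaling dimension above `ℓ + 1 + δτ` with `δτ = 10⁻⁶`"*, §4.2) up to `E₀`;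
* the tail `Δ ≥ E₀` above the unitarity bound, every spin of the sector's parity (no threshold used:
  tail rules are uniform in `Δ`).

Main statements:
* `O2Obligations α A D E₀` (the list) and `O2Obligations.isPositiveFor_zero : … → IsPositiveFor α A D 0`
  (case analysis on `Δ < E₀`, `ℓ = 0` and the two exact disjuncts; elementary);
* `O2Obligations.of_weaker` (a list against weaker assumptions serves stronger ones),
  `O2Obligations.isPositiveFor` (with the external condition at `l`);
* the kernel dictionary for scan functionals (`O2OPEScanBridge.ScanFunctional`: nodes + weights):
  `alphaMat_pointFunctional₂₂` / `alphaMat_toFunctional` — `α(V⃗)` of a point functional is the finite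
  combination `Σ_m Σ_r w_{m r} · V⃗_r(u_m, v_m)` of the crossing MATRICES at the nodes, so every item of
  the list is positive-semidefiniteness (or nonnegativity) of an explicit finite combination of the
  22 crossing rows of `O2ThreeScalarCrossing` evaluated at the nodes, over the genuine block values
  there (`pos0p_toFunctional_iff`, `pos2m_toFunctional_iff` spell two of them out);
* the assembled certificate shapes `boxExcluded_of_obligations` (lists + enclosures of the external
  forms + certified cover trees, data depending on the point) and `boxExcluded_of_uniformObligations`
  (one list of functionals for a whole box `Q`), through `O2OPEScanBridge.boxExcluded_of_coverTrees`.

HONEST LIMITS.  Nothing here evaluates a conformal block: the items quantify over GENUINE block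
families (`GenuineOn`), and discharging them needs certified enclosures of `g^{Δ₁₂,Δ₃₄}_{Δ,ℓ}` and of
their large-`Δ` behaviour at the nodes (the `ConformalBootstrap3D` layer; for the `O(2)` system the
labels with `Δ₁₂, Δ₃₄ ≠ 0` are needed), exactly as for the archipelago files.  The split at `E₀` is a
bookkeeping choice (any `E₀` gives `IsPositiveFor α A D 0`); no claim is made about which `E₀` makes the
tail items provable.  RECORD of the engines lane; no published number is touched.
-/

noncomputable section

open Set Finset Matrix

namespace Literature.MathematicalPhysics.QuantumFieldTheory.O2ScanObligations

open Literature.MathematicalPhysics.QuantumFieldTheory.ConformalBootstrap3D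
open O2ThreeScalarCrossing O2ThreeScalarSystem OPESpaceCoverCertificate O2OPEScanBridge

/-! ## 1. Sector conditions at one `(Δ, ℓ)` -/

section Sector

variable (α : (ℝ → ℝ → Fin 22 → ℝ) →ₗ[ℝ] ℝ) (D : Dims) (Δ : ℝ) (ℓ : ℕ)

/-- `0⁺` at `(Δ, ℓ)`: `α(V⃗_{0⁺,Δ,ℓ}) ⪰ 0` (`3 × 3`) for every genuine block family on the `0⁺` labels.
[cite: ChesterEtAl2020, §3.1 (functional conditions)] -/
def Pos0p : Prop :=
  ∀ g : Label → ℝ → ℝ → ℝ, GenuineOn D labels0p Δ ℓ g → (alphaMat α (V0p D g)).PosSemidef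

/-- `0⁻` at `(Δ, ℓ)`: `α(V⃗_{0⁻,Δ,ℓ}) ⪰ 0` (`2 × 2`). [cite: ChesterEtAl2020, §3.1 (functional conditions)] -/
def Pos0m : Prop :=
  ∀ g : Label → ℝ → ℝ → ℝ, GenuineOn D labels0m Δ ℓ g → (alphaMat α (V0m D g)).PosSemidef

/-- Charge `1` at `(Δ, ℓ)`: `α(V⃗_1[(−1)^ℓ]) ⪰ 0` (`2 × 2`). [cite: ChesterEtAl2020, §3.1 (functional conditions)] -/
def Pos1 : Prop :=
  ∀ g : Label → ℝ → ℝ → ℝ, GenuineOn D labels1 Δ ℓ g → (alphaMat α (V1 D ((-1) ^ ℓ) g)).PosSemidef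

/-- `2⁺` at `(Δ, ℓ)`: `α(V⃗_{2⁺,Δ,ℓ}) ⪰ 0` (`2 × 2`). [cite: ChesterEtAl2020, §3.1 (functional conditions)] -/
def Pos2p : Prop :=
  ∀ g : Label → ℝ → ℝ → ℝ, GenuineOn D labels2p Δ ℓ g → (alphaMat α (V2p D g)).PosSemidef

/-- `2⁻` at `(Δ, ℓ)`: `α(V⃗_{2⁻,Δ,ℓ}) ≥ 0`. [cite: ChesterEtAl2020, §3.1 (functional conditions)] -/
def Pos2m : Prop :=
  ∀ g : Label → ℝ → ℝ → ℝ, GenuineOn D labels2m Δ ℓ g → 0 ≤ α (V2m D g)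

/-- Charge `3` at `(Δ, ℓ)`: `α(V⃗_3[(−1)^ℓ]) ≥ 0`. [cite: ChesterEtAl2020, §3.1 (functional conditions)] -/
def Pos3 : Prop :=
  ∀ g : Label → ℝ → ℝ → ℝ, GenuineOn D labels3 Δ ℓ g → 0 ≤ α (V3 D ((-1) ^ ℓ) g)

/-- Charge `4` at `(Δ, ℓ)`: `α(V⃗_4) ≥ 0`. [cite: ChesterEtAl2020, §3.1 (functional conditions)] -/
def Pos4 : Prop :=
  ∀ g : Label → ℝ → ℝ → ℝ, GenuineOn D labels4 Δ ℓ g → 0 ≤ α (V4 D g)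

/-- The unit normalisation `(1 1 1) α(V⃗_{0⁺,0,0}) (1;1;1) > 0`. [cite: ChesterEtAl2020, §3.1 (functional conditions)] -/
def UnitPos : Prop :=
  0 < ![(1 : ℝ), 1, 1] ⬝ᵥ (alphaMat α (V0p D unitBlocks) *ᵥ ![(1 : ℝ), 1, 1])

end Sector

/-- The unitarity value for scalars. [cite: PolandRychkovVichi2019, §II.C eq. (19)] -/
private theorem unitarityBound3D_zero : unitarityBound3D 0 = 1 / 2 := by
  simp [unitarityBound3D]

/-- The unitarity value for `ℓ ≠ 0`. [cite: PolandRychkovVichi2019, §II.C eq. (19)] -/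
private theorem unitarityBound3D_of_ne_zero {ℓ : ℕ} (h : ℓ ≠ 0) : unitarityBound3D ℓ = (ℓ : ℝ) + 1 := by
  simp [unitarityBound3D, h]

/-! ## 2. The obligation list -/

/-- **The obligations of a scan functional** `α` at the external dimensions `D`, against the assumptions
`A`, with head threshold `E₀`: the `l`-independent conditions of §3.1 with every sector's admissible
set (§2.2) split into scalars below `E₀`, the exactly-placed stress tensor / current, spinning
primaries from the twist threshold below `E₀`, and the tail `Δ ≥ E₀`.
[cite: ChesterEtAl2020, §3.1 (functional conditions), §2.2 (assumptions about the spectrum)] -/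
structure O2Obligations (α : (ℝ → ℝ → Fin 22 → ℝ) →ₗ[ℝ] ℝ) (A : O2Gaps) (D : Dims) (E₀ : ℝ) :
    Prop where
  /-- (N) unit normalisation. -/
  unit_pos : UnitPos α D
  /-- (0⁺, scalars) `Δ0 ≤ Δ`, `1/2 ≤ Δ`, `Δ < E₀`. -/
  scalar_0p : ∀ Δ : ℝ, 1 / 2 ≤ Δ → A.Δ0 ≤ Δ → Δ < E₀ → Pos0p α D Δ 0
  /-- (0⁺, T) the stress tensor, `(ℓ, Δ) = (2, 3)`. -/
  stress_0p : Pos0p α D 3 2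
  /-- (0⁺, spinning) even `ℓ ≠ 0`, from the twist threshold, below `E₀`. -/
  spinning_0p : ∀ ℓ : ℕ, Even ℓ → ℓ ≠ 0 → ∀ Δ : ℝ, (ℓ : ℝ) + 1 ≤ Δ → (ℓ : ℝ) + 1 + A.δτ ≤ Δ →
    Δ < E₀ → Pos0p α D Δ ℓ
  /-- (0⁺, tail) even spins, `Δ ≥ E₀` above the unitarity bound. -/
  tail_0p : ∀ ℓ : ℕ, Even ℓ → ∀ Δ : ℝ, unitarityBound3D ℓ ≤ Δ → E₀ ≤ Δ → Pos0p α D Δ ℓ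
  /-- (0⁻, J) the conserved current, `(ℓ, Δ) = (1, 2)`. -/
  current_0m : Pos0m α D 2 1
  /-- (0⁻, spinning) odd spins from the twist threshold, below `E₀`. -/
  spinning_0m : ∀ ℓ : ℕ, Odd ℓ → ∀ Δ : ℝ, (ℓ : ℝ) + 1 ≤ Δ → (ℓ : ℝ) + 1 + A.δτ ≤ Δ → Δ < E₀ →
    Pos0m α D Δ ℓ
  /-- (0⁻, tail) odd spins, `Δ ≥ E₀` above the unitarity bound. -/
  tail_0m : ∀ ℓ : ℕ, Odd ℓ → ∀ Δ : ℝ, unitarityBound3D ℓ ≤ Δ → E₀ ≤ Δ → Pos0m α D Δ ℓ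
  /-- (1, scalars) `Δ1 ≤ Δ`, `1/2 ≤ Δ`, `Δ < E₀`. -/
  scalar_1 : ∀ Δ : ℝ, 1 / 2 ≤ Δ → A.Δ1 ≤ Δ → Δ < E₀ → Pos1 α D Δ 0
  /-- (1, spinning) every `ℓ ≠ 0` from the twist threshold, below `E₀`. -/
  spinning_1 : ∀ ℓ : ℕ, ℓ ≠ 0 → ∀ Δ : ℝ, (ℓ : ℝ) + 1 ≤ Δ → (ℓ : ℝ) + 1 + A.δτ ≤ Δ → Δ < E₀ →
    Pos1 α D Δ ℓ
  /-- (1, tail) every spin. -/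
  tail_1 : ∀ ℓ : ℕ, ∀ Δ : ℝ, unitarityBound3D ℓ ≤ Δ → E₀ ≤ Δ → Pos1 α D Δ ℓ
  /-- (2⁺, scalars) `Δ2 ≤ Δ`, `1/2 ≤ Δ`, `Δ < E₀`. -/
  scalar_2p : ∀ Δ : ℝ, 1 / 2 ≤ Δ → A.Δ2 ≤ Δ → Δ < E₀ → Pos2p α D Δ 0
  /-- (2⁺, spinning) even `ℓ ≠ 0` from the twist threshold, below `E₀`. -/
  spinning_2p : ∀ ℓ : ℕ, Even ℓ → ℓ ≠ 0 → ∀ Δ : ℝ, (ℓ : ℝ) + 1 ≤ Δ → (ℓ : ℝ) + 1 + A.δτ ≤ Δ →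
    Δ < E₀ → Pos2p α D Δ ℓ
  /-- (2⁺, tail) even spins. -/
  tail_2p : ∀ ℓ : ℕ, Even ℓ → ∀ Δ : ℝ, unitarityBound3D ℓ ≤ Δ → E₀ ≤ Δ → Pos2p α D Δ ℓ
  /-- (2⁻, spinning) odd spins from the twist threshold, below `E₀`. -/
  spinning_2m : ∀ ℓ : ℕ, Odd ℓ → ∀ Δ : ℝ, (ℓ : ℝ) + 1 ≤ Δ → (ℓ : ℝ) + 1 + A.δτ ≤ Δ → Δ < E₀ →
    Pos2m α D Δ ℓ
  /-- (2⁻, tail) odd spins. -/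
  tail_2m : ∀ ℓ : ℕ, Odd ℓ → ∀ Δ : ℝ, unitarityBound3D ℓ ≤ Δ → E₀ ≤ Δ → Pos2m α D Δ ℓ
  /-- (3, scalars) `Δ3 ≤ Δ`, `1/2 ≤ Δ`, `Δ < E₀`. -/
  scalar_3 : ∀ Δ : ℝ, 1 / 2 ≤ Δ → A.Δ3 ≤ Δ → Δ < E₀ → Pos3 α D Δ 0
  /-- (3, spinning) every `ℓ ≠ 0` from the twist threshold, below `E₀`. -/
  spinning_3 : ∀ ℓ : ℕ, ℓ ≠ 0 → ∀ Δ : ℝ, (ℓ : ℝ) + 1 ≤ Δ → (ℓ : ℝ) + 1 + A.δτ ≤ Δ → Δ < E₀ →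
    Pos3 α D Δ ℓ
  /-- (3, tail) every spin. -/
  tail_3 : ∀ ℓ : ℕ, ∀ Δ : ℝ, unitarityBound3D ℓ ≤ Δ → E₀ ≤ Δ → Pos3 α D Δ ℓ
  /-- (4, scalars) `Δ4 ≤ Δ`, `1/2 ≤ Δ`, `Δ < E₀`. -/
  scalar_4 : ∀ Δ : ℝ, 1 / 2 ≤ Δ → A.Δ4 ≤ Δ → Δ < E₀ → Pos4 α D Δ 0
  /-- (4, spinning) even `ℓ ≠ 0` from the twist threshold, below `E₀`. -/
  spinning_4 : ∀ ℓ : ℕ, Even ℓ → ℓ ≠ 0 → ∀ Δ : ℝ, (ℓ : ℝ) + 1 ≤ Δ → (ℓ : ℝ) + 1 + A.δτ ≤ Δ →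
    Δ < E₀ → Pos4 α D Δ ℓ
  /-- (4, tail) even spins. -/
  tail_4 : ∀ ℓ : ℕ, Even ℓ → ∀ Δ : ℝ, unitarityBound3D ℓ ≤ Δ → E₀ ≤ Δ → Pos4 α D Δ ℓ

namespace O2Obligations

variable {α : (ℝ → ℝ → Fin 22 → ℝ) →ₗ[ℝ] ℝ} {A A' : O2Gaps} {D : Dims} {E₀ : ℝ}

/-- **The list is the `l`-independent half of the functional conditions**: `O2Obligations α A D E₀`
gives `IsPositiveFor α A D 0` (the external condition is void at `l = 0`).  Case analysis on
`Δ < E₀` / `E₀ ≤ Δ`, on `ℓ = 0`, and on the exact disjuncts of `Allows0p` (`ℓ = 2 ∧ Δ = 3`) and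
`Allows0m` (`ℓ = 1 ∧ Δ = 2`). [cite: ChesterEtAl2020, §3.1 (functional conditions), §2.2 (assumptions about the spectrum)] -/
theorem isPositiveFor_zero (h : O2Obligations α A D E₀) : IsPositiveFor α A D 0 := by
  refine ⟨h.unit_pos, fun gs gφ gt _ _ _ => by simp, ?_, ?_, ?_, ?_, ?_, ?_, ?_⟩
  · -- sector 0⁺
    rintro Δ ℓ g ⟨hev, hb, hsc, htw⟩ hg
    rcases lt_or_ge Δ E₀ with hlt | hge
    · by_cases h0 : ℓ = 0
      · subst h0
        rw [unitarityBound3D_zero] at hb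
        exact h.scalar_0p Δ hb (hsc rfl) hlt g hg
      · rw [unitarityBound3D_of_ne_zero h0] at hb
        rcases htw (Nat.one_le_iff_ne_zero.mpr h0) with ⟨rfl, rfl⟩ | htw'
        · exact h.stress_0p g hg
        · exact h.spinning_0p ℓ hev h0 Δ hb htw' hlt g hg
    · exact h.tail_0p ℓ hev Δ hb hge g hg
  · -- sector 0⁻
    rintro Δ ℓ g ⟨hodd, hb, hJ⟩ hg
    rcases lt_or_ge Δ E₀ with hlt | hge
    · have h0 : ℓ ≠ 0 := by rintro rfl; exact Nat.not_odd_zero hodd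
      rw [unitarityBound3D_of_ne_zero h0] at hb
      rcases hJ with ⟨rfl, rfl⟩ | htw'
      · exact h.current_0m g hg
      · exact h.spinning_0m ℓ hodd Δ hb htw' hlt g hg
    · exact h.tail_0m ℓ hodd Δ hb hge g hg
  · -- sector 1
    rintro Δ ℓ g ⟨hb, hsc, htw⟩ hg
    rcases lt_or_ge Δ E₀ with hlt | hge
    · by_cases h0 : ℓ = 0
      · subst h0
        rw [unitarityBound3D_zero] at hb
        exact h.scalar_1 Δ hb (hsc rfl) hlt g hg
      · rw [unitarityBound3D_of_ne_zero h0] at hb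
        exact h.spinning_1 ℓ h0 Δ hb (htw (Nat.one_le_iff_ne_zero.mpr h0)) hlt g hg
    · exact h.tail_1 ℓ Δ hb hge g hg
  · -- sector 2⁺
    rintro Δ ℓ g ⟨hev, hb, hsc, htw⟩ hg
    rcases lt_or_ge Δ E₀ with hlt | hge
    · by_cases h0 : ℓ = 0
      · subst h0
        rw [unitarityBound3D_zero] at hb
        exact h.scalar_2p Δ hb (hsc rfl) hlt g hg
      · rw [unitarityBound3D_of_ne_zero h0] at hb
        exact h.spinning_2p ℓ hev h0 Δ hb (htw (Nat.one_le_iff_ne_zero.mpr h0)) hlt g hg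
    · exact h.tail_2p ℓ hev Δ hb hge g hg
  · -- sector 2⁻
    rintro Δ ℓ g ⟨hodd, hb, htw⟩ hg
    rcases lt_or_ge Δ E₀ with hlt | hge
    · have h0 : ℓ ≠ 0 := by rintro rfl; exact Nat.not_odd_zero hodd
      rw [unitarityBound3D_of_ne_zero h0] at hb
      exact h.spinning_2m ℓ hodd Δ hb htw hlt g hg
    · exact h.tail_2m ℓ hodd Δ hb hge g hg
  · -- sector 3
    rintro Δ ℓ g ⟨hb, hsc, htw⟩ hg
    rcases lt_or_ge Δ E₀ with hlt | hge
    · by_cases h0 : ℓ = 0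
      · subst h0
        rw [unitarityBound3D_zero] at hb
        exact h.scalar_3 Δ hb (hsc rfl) hlt g hg
      · rw [unitarityBound3D_of_ne_zero h0] at hb
        exact h.spinning_3 ℓ h0 Δ hb (htw (Nat.one_le_iff_ne_zero.mpr h0)) hlt g hg
    · exact h.tail_3 ℓ Δ hb hge g hg
  · -- sector 4
    rintro Δ ℓ g ⟨hev, hb, hsc, htw⟩ hg
    rcases lt_or_ge Δ E₀ with hlt | hge
    · by_cases h0 : ℓ = 0
      · subst h0
        rw [unitarityBound3D_zero] at hb
        exact h.scalar_4 Δ hb (hsc rfl) hlt g hg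
      · rw [unitarityBound3D_of_ne_zero h0] at hb
        exact h.spinning_4 ℓ hev h0 Δ hb (htw (Nat.one_le_iff_ne_zero.mpr h0)) hlt g hg
    · exact h.tail_4 ℓ hev Δ hb hge g hg

/-- With the external condition at a class `l` the list gives the full functional conditions there.
[cite: ChesterEtAl2020, §3.1 (functional conditions), §3.2 (weaker condition)] -/
theorem isPositiveFor (h : O2Obligations α A D E₀) {l : Fin 4 → ℝ} (hext : ExtNonnegAt α D l) :
    IsPositiveFor α A D l :=
  isPositiveFor_of_zero_of_ext h.isPositiveFor_zero hext

/-- Monotonicity in the assumptions: a list against `A` serves every `A'` with `A.Weaker A'`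
(larger thresholds and twist gap: fewer items). [cite: ChesterEtAl2020, §2.2 (assumptions about the spectrum)] -/
theorem of_weaker (h : O2Obligations α A D E₀) (hw : A.Weaker A') : O2Obligations α A' D E₀ := by
  obtain ⟨h0, h1, h2, h3, h4, hτ⟩ := hw
  have hτ' : ∀ (ℓ : ℕ) (Δ : ℝ), (ℓ : ℝ) + 1 + A'.δτ ≤ Δ → (ℓ : ℝ) + 1 + A.δτ ≤ Δ :=
    fun ℓ Δ hΔ => le_trans (by linarith) hΔ
  exact
    { unit_pos := h.unit_pos
      scalar_0p := fun Δ hb hΔ hlt => h.scalar_0p Δ hb (h0.trans hΔ) hlt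
      stress_0p := h.stress_0p
      spinning_0p := fun ℓ hev hℓ Δ hb htw hlt => h.spinning_0p ℓ hev hℓ Δ hb (hτ' ℓ Δ htw) hlt
      tail_0p := h.tail_0p
      current_0m := h.current_0m
      spinning_0m := fun ℓ ho Δ hb htw hlt => h.spinning_0m ℓ ho Δ hb (hτ' ℓ Δ htw) hlt
      tail_0m := h.tail_0m
      scalar_1 := fun Δ hb hΔ hlt => h.scalar_1 Δ hb (h1.trans hΔ) hlt
      spinning_1 := fun ℓ hℓ Δ hb htw hlt => h.spinning_1 ℓ hℓ Δ hb (hτ' ℓ Δ htw) hlt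
      tail_1 := h.tail_1
      scalar_2p := fun Δ hb hΔ hlt => h.scalar_2p Δ hb (h2.trans hΔ) hlt
      spinning_2p := fun ℓ hev hℓ Δ hb htw hlt => h.spinning_2p ℓ hev hℓ Δ hb (hτ' ℓ Δ htw) hlt
      tail_2p := h.tail_2p
      spinning_2m := fun ℓ ho Δ hb htw hlt => h.spinning_2m ℓ ho Δ hb (hτ' ℓ Δ htw) hlt
      tail_2m := h.tail_2m
      scalar_3 := fun Δ hb hΔ hlt => h.scalar_3 Δ hb (h3.trans hΔ) hlt
      spinning_3 := fun ℓ hℓ Δ hb htw hlt => h.spinning_3 ℓ hℓ Δ hb (hτ' ℓ Δ htw) hlt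
      tail_3 := h.tail_3
      scalar_4 := fun Δ hb hΔ hlt => h.scalar_4 Δ hb (h4.trans hΔ) hlt
      spinning_4 := fun ℓ hev hℓ Δ hb htw hlt => h.spinning_4 ℓ hev hℓ Δ hb (hτ' ℓ Δ htw) hlt
      tail_4 := h.tail_4 }

end O2Obligations

/-! ## 3. The kernel dictionary: `α(V⃗)` of a point functional -/

/-- `α(V⃗)` of a point functional is the finite combination of the crossing matrices at the nodes:
`α(V⃗)_{ij} = Σ_m Σ_r w_{m r} (V⃗_r(u_m, v_m))_{ij}`. [cite: ChesterEtAl2020, §3.1 (functional conditions)] -/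
theorem alphaMat_pointFunctional₂₂ {M n : ℕ} (w : Fin M → Fin 22 → ℝ) (u v : Fin M → ℝ)
    (V : ℝ → ℝ → Fin 22 → Matrix (Fin n) (Fin n) ℝ) :
    alphaMat (pointFunctional₂₂ w u v) V = ∑ m, ∑ r, w m r • V (u m) (v m) r := by
  ext i j
  simp only [alphaMat_apply, pointFunctional₂₂_apply, Matrix.sum_apply, Matrix.smul_apply, smul_eq_mul]

/-- The same for a scan functional (`F.toFunctional = pointFunctional₂₂ F.w F.u F.v`).
[cite: ChesterEtAl2020, §3.1 (functional conditions)] -/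
theorem alphaMat_toFunctional {n : ℕ} (F : ScanFunctional)
    (V : ℝ → ℝ → Fin 22 → Matrix (Fin n) (Fin n) ℝ) :
    alphaMat F.toFunctional V = ∑ m, ∑ r, F.w m r • V (F.u m) (F.v m) r :=
  alphaMat_pointFunctional₂₂ F.w F.u F.v V

/-- A scan functional on a 22-vector of scalar rows. [cite: ChesterEtAl2020, §3.1 (functional conditions)] -/
theorem toFunctional_apply (F : ScanFunctional) (G : ℝ → ℝ → Fin 22 → ℝ) :
    F.toFunctional G = ∑ m, ∑ r, F.w m r * G (F.u m) (F.v m) r :=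
  rfl

/-- The `0⁺` item of a scan functional, spelled out: positive-semidefiniteness of the explicit `3 × 3`
combination `Σ_m Σ_r w_{m r} V⃗_{0⁺,r}(u_m, v_m)` of the crossing matrices at the nodes, for every genuine
block family. [cite: ChesterEtAl2020, §3.1 (functional conditions)] -/
theorem pos0p_toFunctional_iff (F : ScanFunctional) (D : Dims) (Δ : ℝ) (ℓ : ℕ) :
    Pos0p F.toFunctional D Δ ℓ ↔ ∀ g : Label → ℝ → ℝ → ℝ, GenuineOn D labels0p Δ ℓ g →
      (∑ m, ∑ r, F.w m r • V0p D g (F.u m) (F.v m) r).PosSemidef := by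
  simp only [Pos0p, alphaMat_toFunctional]

/-- The `2⁻` item of a scan functional, spelled out: nonnegativity of the explicit number
`Σ_m Σ_r w_{m r} (V⃗_{2⁻}(u_m, v_m))_r`. [cite: ChesterEtAl2020, §3.1 (functional conditions)] -/
theorem pos2m_toFunctional_iff (F : ScanFunctional) (D : Dims) (Δ : ℝ) (ℓ : ℕ) :
    Pos2m F.toFunctional D Δ ℓ ↔ ∀ g : Label → ℝ → ℝ → ℝ, GenuineOn D labels2m Δ ℓ g →
      0 ≤ ∑ m, ∑ r, F.w m r * V2m D g (F.u m) (F.v m) r := by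
  simp only [Pos2m, toFunctional_apply]

/-- The unit item of a scan functional, spelled out (the unit rows are block-free: `unitBlocks`).
[cite: ChesterEtAl2020, §3.1 (functional conditions)] -/
theorem unitPos_toFunctional_iff (F : ScanFunctional) (D : Dims) :
    UnitPos F.toFunctional D ↔
      0 < ![(1 : ℝ), 1, 1] ⬝ᵥ ((∑ m, ∑ r, F.w m r • V0p D unitBlocks (F.u m) (F.v m) r) *ᵥ
        ![(1 : ℝ), 1, 1]) := by
  simp only [UnitPos, alphaMat_toFunctional]

/-! ## 4. The assembled certificate shapes -/

/-- **Box exclusion from obligation lists** (data depending on the point `D ∈ Q`): for every `D ∈ Q` a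
finite family of scan functionals each with its obligation list discharged, entrywise enclosures of
their external forms, and for each facet of the cube in `ℝ⁴` a cover tree certified for the interval
vertex test. [cite: ChesterEtAl2020, §3.3 (allowed and disallowed points; Algorithm 1), §3.1 (functional conditions)] -/
theorem boxExcluded_of_obligations {A : O2Gaps} {Q : Set (ℝ × ℝ × ℝ)} (ι : Dims → Type*)
    (F : ∀ D, ι D → ScanFunctional) (E₀ : ∀ D, ι D → ℝ)
    (Blo Bhi : ∀ D, ι D → Matrix (Fin 4) (Fin 4) ℝ) (T : ∀ D, Fin 4 → CoverTree (ι D) 4)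
    (hobl : ∀ D : Dims, (D.Δs, D.Δφ, D.Δt) ∈ Q →
      ∀ k, O2Obligations (F D k).toFunctional A D (E₀ D k))
    (henc : ∀ D : Dims, (D.Δs, D.Δφ, D.Δt) ∈ Q →
      ∀ k, ExtEnclosed (F D k).toFunctional D (Blo D k) (Bhi D k))
    (hT : ∀ D : Dims, (D.Δs, D.Δφ, D.Δt) ∈ Q → ∀ i : Fin 4,
      (T D i).Certifies (intervalVertexTest (Blo D) (Bhi D)) (facetLo i) (fun _ => (1 : ℝ))) :
    BoxExcluded A Q :=
  boxExcluded_of_coverTrees ι F Blo Bhi T (fun D hD k => (hobl D hD k).isPositiveFor_zero) henc hT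

/-- **Uniform certificate for a box** — ONE list of scan functionals whose obligation lists are
discharged at every point of `Q`, ONE family of enclosures valid on `Q`, FOUR certified trees.
[cite: ChesterEtAl2020, §3.3 (allowed and disallowed points; Algorithm 1), §3.1 (functional conditions)] -/
theorem boxExcluded_of_uniformObligations {A : O2Gaps} {Q : Set (ℝ × ℝ × ℝ)} {ι : Type*}
    (F : ι → ScanFunctional) (E₀ : ι → ℝ) (Blo Bhi : ι → Matrix (Fin 4) (Fin 4) ℝ)
    (T : Fin 4 → CoverTree ι 4)
    (hobl : ∀ D : Dims, (D.Δs, D.Δφ, D.Δt) ∈ Q → ∀ k, O2Obligations (F k).toFunctional A D (E₀ k))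
    (henc : ∀ D : Dims, (D.Δs, D.Δφ, D.Δt) ∈ Q → ∀ k, ExtEnclosed (F k).toFunctional D (Blo k) (Bhi k))
    (hT : ∀ i : Fin 4, (T i).Certifies (intervalVertexTest Blo Bhi) (facetLo i) (fun _ => (1 : ℝ))) :
    BoxExcluded A Q :=
  boxExcluded_of_uniformCoverTrees F Blo Bhi T (fun D hD k => (hobl D hD k).isPositiveFor_zero) henc hT

/-- Exclusion of a box under assumptions `A'` from a certificate against WEAKER assumptions `A`
(`A.Weaker A'`), e.g. a certificate against `chesterGapsInitial` also excludes under `chesterGaps`.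
[cite: ChesterEtAl2020, §2.2 (assumptions about the spectrum), §4.1 (gap assumptions)] -/
theorem boxExcluded_of_uniformObligations_of_weaker {A A' : O2Gaps} {Q : Set (ℝ × ℝ × ℝ)} {ι : Type*}
    (hw : A.Weaker A') (F : ι → ScanFunctional) (E₀ : ι → ℝ) (Blo Bhi : ι → Matrix (Fin 4) (Fin 4) ℝ)
    (T : Fin 4 → CoverTree ι 4)
    (hobl : ∀ D : Dims, (D.Δs, D.Δφ, D.Δt) ∈ Q → ∀ k, O2Obligations (F k).toFunctional A D (E₀ k))
    (henc : ∀ D : Dims, (D.Δs, D.Δφ, D.Δt) ∈ Q → ∀ k, ExtEnclosed (F k).toFunctional D (Blo k) (Bhi k))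
    (hT : ∀ i : Fin 4, (T i).Certifies (intervalVertexTest Blo Bhi) (facetLo i) (fun _ => (1 : ℝ))) :
    BoxExcluded A' Q :=
  (boxExcluded_of_uniformObligations F E₀ Blo Bhi T hobl henc hT).of_weaker hw

end Literature.MathematicalPhysics.QuantumFieldTheory.O2ScanObligations

end
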